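import Summits.HodgeConjecture.CorCM.PrimeDegreeSlotPairsHodge
import HarnessLib

/-!
# Simple CM abelian varieties of PAIRWISE DISTINCT PRIME dimensions, and a prime-dimensional one against surfaces,
# threefolds, fourfolds: a shared imaginary quadratic field is the only obstruction to `B• = D•` on all products

COR-CM (cell `pub-hodgecm2`, binder seat `b16` gen 46, count-neutral claim PRIME-SLOT, file F4; theorems only, no
definition, no named fact, no `sorry`).  NEW as stated, hence under `Summits/`.  Instances and the `n`-slot form of
`CorCM/PrimeDegreeSlotPairsHodge` (a CM field of degree `2p`, `p` an odd prime, against any CM field of smaller degree: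
no common constituent unless an imaginary quadratic subfield is shared).

* §1 `isEmpty_ringHom_of_smul_smul_of_isTotallyComplex`, **`not_exists_quadratic_of_isPrimitive_quartic`** — a quartic
  CM field with a PRIMITIVE type receives no imaginary quadratic field (conjugation on its embeddings is a square (□),
  p2's `QuarticCM.exists_ringAut_smul_smul_eq_conjugate_of_isPrimitive`, while `τ²` is the identity on the two
  embeddings of an imaginary quadratic field).
* §2 named pairs, on the varieties (`A_{i₀}` SIMPLE of PRIME dimension `p ≥ 3`):
  **`hodgeConjectureFor_prod_primeDim_simpleSurface`** — times ANY SIMPLE CM abelian SURFACE: the Hodge conjecture and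
  `B• = D•` on every `A^a × S^b`, UNCONDITIONALLY and with NO hypothesis on the fields (`p = 3` is this seat's gen-38
  `hodgeConjectureFor_prod_simpleSurface_simpleThreefold`; `p = 5, 7, …` are new: every simple CM fivefold or sevenfold
  times every simple CM surface); **`isNondegenerateFamily_iff_primeDim_simple_dim_le_three`** — times a SIMPLE CM abelian
  variety of dimension `≤ 3` (and `< p`): nondegenerate iff no imaginary quadratic subfield of `End⁰(A_{i₀})` embeds in
  `End⁰(A_{i₁})`, with `hodgeConjectureFor_prod_primeDim_simple_dim_le_three` and the exceptional-class converse
  `exists_exceptional_prod_iff_primeDim_simple_dim_le_three` (for `p = 5`: fivefold × simple threefold; `p = 7`: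
  sevenfold × simple threefold); a simple FOURFOLD partner (`p ≥ 5`) is `isNondegenerateFamily_iff_of_prime_dim` itself
  (nondegenerate iff the fourfold is not of Weil type and no imaginary quadratic field is shared).
* §3 **`isNondegenerateFamily_iff_of_distinct_primes`** — ANY NUMBER of slots with `[K_i : ℚ] = 2p_i`, the `p_i` PAIRWISE
  DISTINCT PRIMES (`2` allowed), any types: `(Φ_i)_i` is nondegenerate ⟺ every `Φ_i` is nondegenerate ∧ for all `i ≠ j` no
  imaginary quadratic subfield of `K_i` embeds in `K_j` (each pair is a prime slot against a smaller one); on SIMPLE CM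
  abelian varieties of pairwise distinct prime dimensions (`2, 3, 5, 7, 11, …`; primitive types are nondegenerate by
  Yanai): **`forall_prod_hodgeClassSpan_eq_iff_of_distinct_prime_dims`** (`B• = D•` on EVERY `∏_i A_i^{k_i}` iff the CM
  fields pairwise share no imaginary quadratic subfield), **`hodgeConjectureFor_prod_of_distinct_prime_dims`** (then the
  Hodge conjecture on all of them, UNCONDITIONALLY), `exists_exceptional_prod_iff_of_distinct_prime_dims`.

HONEST FRAMING: the Hodge conjecture for NAMED classes of CM abelian varieties; `HC_CM` is neither used nor asserted.

## References

* [Gordon1999HodgeAVSurvey] B. B. Gordon, *A survey of the Hodge conjecture for abelian varieties*, §3 Theorem (Imai,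
  Murty), 6.3 Remark (Yanai), 7.4–7.7, 9.4, 10.10.
* [MoonenZarhin1999LowDim] B. Moonen, Yu. Zarhin, *Hodge classes on abelian varieties of low dimension*, Math. Ann. 315
  (1999), Thm. (0.2).
* [Shimura1998] G. Shimura, *Abelian Varieties with Complex Multiplication and Modular Functions*, §8.2 Prop. 26, §8.4 (2).
-/

noncomputable section

open CategoryTheory CategoryTheory.Limits NumberField NumberField.ComplexEmbedding Module
open scoped BigOperators

namespace Summit.HodgeConjecture.CorCM

open Literature.NumberTheory.ComplexMultiplication
open Literature.AlgebraicGeometry.Motives (AbelianVariety CMType)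
open Literature.AlgebraicGeometry.HodgeTheory
open Literature.AlgebraicGeometry.ComplexMultiplication (IsCMTypeRealisation isSimple_iff_isPrimitive)
open Literature.AlgebraicGeometry.VanGeemen1994 (hodgeClassSpan)
open Literature.AlgebraicGeometry.Pohlmann1968
open Literature.Barriers.HodgeConjecture (divisorClassesSpan)

/-! ## §1 A quartic CM field with a primitive type receives no imaginary quadratic field -/

section Quartic

variable {k L : Type} [Field k] [NumberField k] [Field L] [NumberField L]

/-- **(□) excludes imaginary quadratic subfields**: if `τ ∘ τ ∘ s = s̄` for every `s : L → ℂ`, no totally complex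
quadratic field `k` embeds in `L` — on the two embeddings `u, ū` of `k` the permutation `τ` has square the identity, but
`u = s ∘ j` would give `τ²u = ū ≠ u`. [cite: Gordon1999HodgeAVSurvey, §3 Theorem (proof)] [cite: Shimura1998, §8.4 (2)] -/
theorem isEmpty_ringHom_of_smul_smul_of_isTotallyComplex [IsTotallyComplex k] (h2 : finrank ℚ k = 2)
    (hτ : ∃ τ : ℂ ≃+* ℂ, ∀ s : L →+* ℂ, τ • τ • s = conjugate s) : IsEmpty (k →+* L) := by
  classical
  obtain ⟨τ, hτ⟩ := hτ
  refine ⟨fun j => ?_⟩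
  obtain ⟨s⟩ : Nonempty (L →+* ℂ) := inferInstance
  set u : k →+* ℂ := s.comp j with hu
  have hne : conjugate u ≠ u := fun h =>
    IsTotallyComplex.complexEmbedding_not_isReal u (ComplexEmbedding.isReal_iff.2 h)
  -- `Hom(k, ℂ) = {u, ū}`
  have htwo : ∀ v : k →+* ℂ, v = u ∨ v = conjugate u := by
    intro v
    by_contra hv
    push Not at hv
    have h3 : ({v, u, conjugate u} : Finset (k →+* ℂ)).card = 3 := by
      rw [Finset.card_insert_of_notMem (by simp [hv.1, hv.2]), Finset.card_insert_of_notMem (by simp [hne.symm]),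
        Finset.card_singleton]
    have hle := Finset.card_le_univ ({v, u, conjugate u} : Finset (k →+* ℂ))
    rw [h3, Embeddings.card, h2] at hle
    omega
  -- `τ² u = ū`
  have hsq : τ • τ • u = conjugate u := by
    rw [hu, conjugate_comp_ringHom, ← hτ s]
    rfl
  rcases htwo (τ • u) with h1 | h1
  · rw [h1, h1] at hsq
    exact hne hsq.symm
  · have h2' : τ • conjugate u = u := by
      rcases htwo (τ • conjugate u) with h3 | h3
      · exact h3
      · exact absurd (MulAction.injective τ (h1.trans h3.symm)) hne.symm
    rw [h1, h2'] at hsq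
    exact hne hsq.symm

variable [IsCMField L]

/-- **A quartic CM field with a PRIMITIVE type receives no imaginary quadratic field**: no `F ≤ K` (`K` any number field)
with `[F:ℚ] = 2`, `F` totally complex, embeds in `L` (biquadratic CM fields carry no primitive type; conjugation on the
embeddings of a cyclic or non-Galois quartic CM field is a square). [cite: Shimura1998, §8.4 (2)] -/
theorem not_exists_quadratic_of_isPrimitive_quartic {K : Type} [Field K] [NumberField K] (h4 : finrank ℚ L = 4)
    (Ψ : CMType L) {φ₀ : L →+* ℂ} (hprim : IsPrimitive (ℂ ≃+* ℂ) Ψ.1 φ₀) :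
    ¬ ∃ F : IntermediateField ℚ K, finrank ℚ F = 2 ∧ IsTotallyComplex F ∧ Nonempty (F →+* L) := by
  rintro ⟨F, hF2, hFtc, ⟨j⟩⟩
  haveI := hFtc
  exact (isEmpty_ringHom_of_smul_smul_of_isTotallyComplex (k := ↥F) hF2
    (QuarticCM.exists_ringAut_smul_smul_eq_conjugate_of_isPrimitive h4 hprim)).false j

end Quartic

/-! ## §2 Named pairs: a simple CM abelian variety of prime dimension against surfaces and small simple partners -/

section Pairs

variable {I : Type} {K : I → Type} [∀ i, Field (K i)] [∀ i, NumberField (K i)] [∀ i, IsCMField (K i)] [Fintype I]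
  [DecidableEq I] {Φ : ∀ i, CMType (K i)}
variable {A : I → AbelianVariety ℂ} {ι : ∀ i, 𝓞 (K i) →+* End (A i)}
  {θ : ∀ i, K i →+* Module.End ℂ (complexBetti (A i).X 1)}

/-- **Every simple CM abelian variety of prime dimension `p ≥ 3` times every SIMPLE CM abelian SURFACE: the Hodge
conjecture and `B• = D•` on every `A^a × S^b`**, UNCONDITIONALLY, with no hypothesis on the fields (a quartic CM field with
a primitive type has no imaginary quadratic subfield; primitive quartic types are nondegenerate).  `p = 3`: this seat's
gen-38 theorem; `p = 5, 7, …`: new. [cite: Gordon1999HodgeAVSurvey, §3 Theorem, 6.3 Remark and 10.10]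
[cite: Shimura1998, §8.2 Prop. 26 and §8.4 (2)] -/
theorem hodgeConjectureFor_prod_primeDim_simpleSurface {i₀ i₁ : I} (h01 : i₀ ≠ i₁) (hI : ∀ j, j = i₀ ∨ j = i₁)
    {p : ℕ} (hp : p.Prime) (hp2 : p ≠ 2) (hA : ∀ i, IsCMTypeRealisation (Φ i) (A i) (ι i) (θ i))
    (hd₀ : (A i₀).dim = p) (hd₁ : (A i₁).dim = 2) (hS : ∀ i, (A i).IsSimple) {N : ℕ} (π : Fin N → I) :
    HodgeConjectureFor (⨁ fun j : Fin N => A (π j)).dim (⨁ fun j : Fin N => A (π j)).X ∧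
      ∀ m : ℕ, hodgeClassSpan (⨁ fun j : Fin N => A (π j)).dim (⨁ fun j : Fin N => A (π j)).X m =
        divisorClassesSpan (⨁ fun j : Fin N => A (π j)).X (⨁ fun j : Fin N => A (π j)).dim m := by
  obtain ⟨φ₁⟩ : Nonempty (K i₁ →+* ℂ) := inferInstance
  have h4 : finrank ℚ (K i₁) = 4 := by rw [finrank_eq_two_mul_dim_of_isCMTypeRealisation (hA i₁), hd₁]
  have hprim := (isSimple_iff_isPrimitive (hA i₁) φ₁).1 (hS i₁)
  have hlt : (A i₁).dim < p := by rw [hd₁]; exact lt_of_le_of_ne hp.two_le (Ne.symm hp2)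
  exact hodgeConjectureFor_prod_of_prime_dim h01 hI hp hp2 hA hd₀ hlt (hS i₀)
    (isNondegenerate_of_isPrimitive_of_finrank_le_six (Φ i₁) (by rw [h4]; norm_num) φ₁ hprim)
    (not_exists_quadratic_of_isPrimitive_quartic h4 (Φ i₁) hprim) π

/-- **A simple CM abelian variety of prime dimension `p` times a SIMPLE CM abelian variety of dimension `≤ 3` (and `< p`):
`Hg(A₀ × A₁) = Hg(A₀) × Hg(A₁)` iff no imaginary quadratic subfield of `End⁰(A_{i₀}) = K_{i₀}` embeds in `K_{i₁}`** (simple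
CM abelian varieties of dimension `≤ 3` are nondegenerate: Ribet's bound). [cite: MoonenZarhin1999LowDim, Thm. (0.2)]
[cite: Gordon1999HodgeAVSurvey, §3 Theorem and 7.5–7.7] -/
theorem isNondegenerateFamily_iff_primeDim_simple_dim_le_three {i₀ i₁ : I} (h01 : i₀ ≠ i₁) (hI : ∀ j, j = i₀ ∨ j = i₁)
    {p : ℕ} (hp : p.Prime) (hp2 : p ≠ 2) (hA : ∀ i, IsCMTypeRealisation (Φ i) (A i) (ι i) (θ i))
    (hd₀ : (A i₀).dim = p) (hd₁ : (A i₁).dim ≤ 3) (hlt : (A i₁).dim < p) (hS : ∀ i, (A i).IsSimple) :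
    CMAlgebra.IsNondegenerateFamily Φ ↔
      ¬ ∃ F : IntermediateField ℚ (K i₀), finrank ℚ F = 2 ∧ IsTotallyComplex F ∧ Nonempty (F →+* K i₁) := by
  obtain ⟨φ₁⟩ : Nonempty (K i₁ →+* ℂ) := inferInstance
  have h6 : finrank ℚ (K i₁) ≤ 6 := by rw [finrank_eq_two_mul_dim_of_isCMTypeRealisation (hA i₁)]; omega
  have hnd₁ := isNondegenerate_of_isPrimitive_of_finrank_le_six (Φ i₁) h6 φ₁
    ((isSimple_iff_isPrimitive (hA i₁) φ₁).1 (hS i₁))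
  rw [isNondegenerateFamily_iff_of_prime_dim h01 hI hp hp2 hA hd₀ hlt (hS i₀)]
  exact ⟨fun H => H.2, fun H => ⟨hnd₁, H⟩⟩

/-- **The Hodge conjecture on every `A₀^a × A₁^b`** for `A_{i₀}` simple of prime dimension `p ≥ 3` and `A_{i₁}` simple of
dimension `≤ 3` (`< p`) whose CM fields share no imaginary quadratic subfield — UNCONDITIONALLY (e.g. every simple CM
fivefold times every simple CM threefold whose sextic field does not contain the imaginary quadratic subfield, if any,
of the decic field). [cite: Gordon1999HodgeAVSurvey, §3 Theorem and 10.10] [cite: MoonenZarhin1999LowDim, Thm. (0.2) (4)] -/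
theorem hodgeConjectureFor_prod_primeDim_simple_dim_le_three {i₀ i₁ : I} (h01 : i₀ ≠ i₁) (hI : ∀ j, j = i₀ ∨ j = i₁)
    {p : ℕ} (hp : p.Prime) (hp2 : p ≠ 2) (hA : ∀ i, IsCMTypeRealisation (Φ i) (A i) (ι i) (θ i))
    (hd₀ : (A i₀).dim = p) (hd₁ : (A i₁).dim ≤ 3) (hlt : (A i₁).dim < p) (hS : ∀ i, (A i).IsSimple)
    (hno : ¬ ∃ F : IntermediateField ℚ (K i₀), finrank ℚ F = 2 ∧ IsTotallyComplex F ∧ Nonempty (F →+* K i₁))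
    {N : ℕ} (π : Fin N → I) :
    HodgeConjectureFor (⨁ fun j : Fin N => A (π j)).dim (⨁ fun j : Fin N => A (π j)).X ∧
      ∀ m : ℕ, hodgeClassSpan (⨁ fun j : Fin N => A (π j)).dim (⨁ fun j : Fin N => A (π j)).X m =
        divisorClassesSpan (⨁ fun j : Fin N => A (π j)).X (⨁ fun j : Fin N => A (π j)).dim m := by
  haveI : Nonempty I := ⟨i₀⟩
  have h := (isNondegenerateFamily_iff_primeDim_simple_dim_le_three h01 hI hp hp2 hA hd₀ hd₁ hlt hS).2 hno
  exact ⟨h.hodgeConjectureFor_prod hA π, fun m => h.hodgeClassSpan_prod_eq_divisorClassesSpan hA π m⟩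

/-- **An exceptional Hodge class on some `A₀^a × A₁^b` iff the fields SHARE an imaginary quadratic subfield** (`A_{i₀}`
simple of prime dimension `p ≥ 3`, `A_{i₁}` simple of dimension `≤ 3` and `< p`, not isogenous to `A_{i₀}`).
[cite: Gordon1999HodgeAVSurvey, 7.5–7.7 and 9.4] -/
theorem exists_exceptional_prod_iff_primeDim_simple_dim_le_three {i₀ i₁ : I} (h01 : i₀ ≠ i₁)
    (hI : ∀ j, j = i₀ ∨ j = i₁) {p : ℕ} (hp : p.Prime) (hp2 : p ≠ 2)
    (hA : ∀ i, IsCMTypeRealisation (Φ i) (A i) (ι i) (θ i)) (hd₀ : (A i₀).dim = p) (hd₁ : (A i₁).dim ≤ 3)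
    (hlt : (A i₁).dim < p) (hS : ∀ i, (A i).IsSimple) (hniso : ∀ i j, i ≠ j → ¬ AbelianVariety.IsIsogenous (A i) (A j)) :
    (∃ (N : ℕ) (π : Fin N → I) (m : ℕ) (c : complexBetti (⨁ fun j : Fin N => A (π j)).X (2 * m)),
        IsRationalClass c ∧
        IsOfHodgeType (⨁ fun j : Fin N => A (π j)).dim (⨁ fun j : Fin N => A (π j)).X (2 * m) m m c ∧
        c ∉ divisorClassesSpan (⨁ fun j : Fin N => A (π j)).X (⨁ fun j : Fin N => A (π j)).dim m) ↔
      ∃ F : IntermediateField ℚ (K i₀), finrank ℚ F = 2 ∧ IsTotallyComplex F ∧ Nonempty (F →+* K i₁) := by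
  obtain ⟨φ₁⟩ : Nonempty (K i₁ →+* ℂ) := inferInstance
  have h6 : finrank ℚ (K i₁) ≤ 6 := by rw [finrank_eq_two_mul_dim_of_isCMTypeRealisation (hA i₁)]; omega
  have hnd₁ := isNondegenerate_of_isPrimitive_of_finrank_le_six (Φ i₁) h6 φ₁
    ((isSimple_iff_isPrimitive (hA i₁) φ₁).1 (hS i₁))
  rw [exists_exceptional_prod_iff_of_prime_dim h01 hI hp hp2 hA hd₀ hlt hS hniso]
  exact ⟨fun H => H.resolve_left (not_not.2 hnd₁), Or.inr⟩

end Pairs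

/-! ## §3 Any number of slots of pairwise distinct prime half-degrees -/

section DistinctPrimes

variable {I : Type} {K : I → Type} [∀ i, Field (K i)] [∀ i, NumberField (K i)] [∀ i, IsCMField (K i)] [Fintype I]
  [DecidableEq I]

/-- **Slots of pairwise distinct prime half-degrees: nondegenerate iff all members are and no two fields share an
imaginary quadratic subfield.**  For CM fields `K_i` of degrees `2p_i`, the `p_i` PAIRWISE DISTINCT PRIMES, and any
types: `(Φ_i)_i` is nondegenerate iff every `Φ_i` is nondegenerate and for all `i ≠ j` no `F ≤ K_i`, `[F:ℚ] = 2`, `F`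
totally complex, embeds in `K_j` (each pair is a prime slot against a smaller slot; p2's pairwise criterion).
[cite: Gordon1999HodgeAVSurvey, §3 Theorem and 7.5–7.7] [cite: Yanai1985, §3–§4] -/
theorem isNondegenerateFamily_iff_of_distinct_primes [Nonempty I] (p : I → ℕ) (hp : ∀ i, (p i).Prime)
    (hinj : Function.Injective p) (hK : ∀ i, finrank ℚ (K i) = 2 * p i) (Φ : ∀ i, CMType (K i)) :
    CMAlgebra.IsNondegenerateFamily Φ ↔ (∀ i, IsNondegenerate (Φ i)) ∧
      ∀ i j, i ≠ j → ¬ ∃ F : IntermediateField ℚ (K i), finrank ℚ F = 2 ∧ IsTotallyComplex F ∧ Nonempty (F →+* K j) := by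
  constructor
  · intro hnd
    refine ⟨fun i => hnd.isNondegenerate i, fun i j hij => ?_⟩
    rintro ⟨F, hF2, hFtc, ⟨f⟩⟩
    haveI := hFtc
    exact not_isNondegenerateFamily_of_shared_imaginary_quadratic (k := ↥F) hF2 hij (algebraMap (↥F) (K i)) f Φ hnd
  · rintro ⟨hnd, hno⟩
    refine (isNondegenerateFamily_iff_forall_of_pairwise Φ fun i j hij => ?_).2 hnd
    have hne : p i ≠ p j := fun h => hij (hinj h)
    rcases lt_or_gt_of_ne hne with hlt | hlt
    · -- `p i < p j`: slot `j` is the prime slot, `i` the smaller one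
      have hj2 : p j ≠ 2 := by have := (hp i).two_le; omega
      exact (pairwise_of_prime_of_not_exists_quadratic Φ (hp j) hj2 (hK j)
        (by rw [hK i]; omega) (hno j i (Ne.symm hij))).2
    · have hi2 : p i ≠ 2 := by have := (hp j).two_le; omega
      exact (pairwise_of_prime_of_not_exists_quadratic Φ (hp i) hi2 (hK i)
        (by rw [hK j]; omega) (hno i j hij)).1

variable {Φ : ∀ i, CMType (K i)} {A : I → AbelianVariety ℂ} {ι : ∀ i, 𝓞 (K i) →+* End (A i)}
  {θ : ∀ i, K i →+* Module.End ℂ (complexBetti (A i).X 1)}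

/-- **Simple CM abelian varieties of pairwise distinct PRIME dimensions: `B• = D•` on EVERY `∏_i A_i^{k_i}` iff the CM
fields pairwise share no imaginary quadratic subfield** (primitive types of prime half-degree are nondegenerate, Yanai).
[cite: Gordon1999HodgeAVSurvey, 6.3 Remark, 7.5–7.7 and 9.4] -/
theorem forall_prod_hodgeClassSpan_eq_iff_of_distinct_prime_dims [Nonempty I] (hp : ∀ i, ((A i).dim).Prime)
    (hinj : Function.Injective fun i => (A i).dim) (hA : ∀ i, IsCMTypeRealisation (Φ i) (A i) (ι i) (θ i))
    (hS : ∀ i, (A i).IsSimple) (hniso : ∀ i j, i ≠ j → ¬ AbelianVariety.IsIsogenous (A i) (A j)) :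
    (∀ (N : ℕ) (π : Fin N → I) (m : ℕ),
        hodgeClassSpan (⨁ fun j : Fin N => A (π j)).dim (⨁ fun j : Fin N => A (π j)).X m =
          divisorClassesSpan (⨁ fun j : Fin N => A (π j)).X (⨁ fun j : Fin N => A (π j)).dim m) ↔
      ∀ i j, i ≠ j →
        ¬ ∃ F : IntermediateField ℚ (K i), finrank ℚ F = 2 ∧ IsTotallyComplex F ∧ Nonempty (F →+* K j) := by
  have hK : ∀ i, finrank ℚ (K i) = 2 * (A i).dim := fun i => finrank_eq_two_mul_dim_of_isCMTypeRealisation (hA i)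
  have hnd : ∀ i, IsNondegenerate (Φ i) := fun i => by
    obtain ⟨φ₀⟩ : Nonempty (K i →+* ℂ) := inferInstance
    exact isNondegenerate_of_isPrimitive_of_prime (hp i) (hK i) φ₀ ((isSimple_iff_isPrimitive (hA i) φ₀).1 (hS i))
  rw [← CMAlgebra.isNondegenerateFamily_iff_forall_prod_hodgeClassSpan_eq
      (CMAlgebra.isSeparatingFamily_of_isSimple_of_pairwise_not_isIsogenous hA hS hniso) hA,
    isNondegenerateFamily_iff_of_distinct_primes (fun i => (A i).dim) hp hinj hK Φ]
  exact ⟨fun H => H.2, fun H => ⟨hnd, H⟩⟩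

/-- **The Hodge conjecture on every product of powers of simple CM abelian varieties of pairwise distinct PRIME dimensions
whose CM fields pairwise share no imaginary quadratic subfield** — with `B• = D•` there, UNCONDITIONALLY (any number of
factors: a simple CM surface, threefold, fivefold, sevenfold, … at once). [cite: Gordon1999HodgeAVSurvey, §3 Theorem, 6.3 Remark and 10.10] -/
theorem hodgeConjectureFor_prod_of_distinct_prime_dims [Nonempty I] (hp : ∀ i, ((A i).dim).Prime)
    (hinj : Function.Injective fun i => (A i).dim) (hA : ∀ i, IsCMTypeRealisation (Φ i) (A i) (ι i) (θ i))
    (hS : ∀ i, (A i).IsSimple)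
    (hno : ∀ i j, i ≠ j →
      ¬ ∃ F : IntermediateField ℚ (K i), finrank ℚ F = 2 ∧ IsTotallyComplex F ∧ Nonempty (F →+* K j))
    {N : ℕ} (π : Fin N → I) :
    HodgeConjectureFor (⨁ fun j : Fin N => A (π j)).dim (⨁ fun j : Fin N => A (π j)).X ∧
      ∀ m : ℕ, hodgeClassSpan (⨁ fun j : Fin N => A (π j)).dim (⨁ fun j : Fin N => A (π j)).X m =
        divisorClassesSpan (⨁ fun j : Fin N => A (π j)).X (⨁ fun j : Fin N => A (π j)).dim m := by
  have hK : ∀ i, finrank ℚ (K i) = 2 * (A i).dim := fun i => finrank_eq_two_mul_dim_of_isCMTypeRealisation (hA i)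
  have hnd : ∀ i, IsNondegenerate (Φ i) := fun i => by
    obtain ⟨φ₀⟩ : Nonempty (K i →+* ℂ) := inferInstance
    exact isNondegenerate_of_isPrimitive_of_prime (hp i) (hK i) φ₀ ((isSimple_iff_isPrimitive (hA i) φ₀).1 (hS i))
  have h := (isNondegenerateFamily_iff_of_distinct_primes (fun i => (A i).dim) hp hinj hK Φ).2 ⟨hnd, hno⟩
  exact ⟨h.hodgeConjectureFor_prod hA π, fun m => h.hodgeClassSpan_prod_eq_divisorClassesSpan hA π m⟩

/-- **An exceptional Hodge class on some product iff two of the CM fields SHARE an imaginary quadratic subfield** (simple,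
pairwise non-isogenous CM abelian varieties of pairwise distinct prime dimensions; the classes are Weil-type classes of
the shared field, not claimed algebraic or non-algebraic here). [cite: Gordon1999HodgeAVSurvey, 7.5–7.7 and 9.4] -/
theorem exists_exceptional_prod_iff_of_distinct_prime_dims [Nonempty I] (hp : ∀ i, ((A i).dim).Prime)
    (hinj : Function.Injective fun i => (A i).dim) (hA : ∀ i, IsCMTypeRealisation (Φ i) (A i) (ι i) (θ i))
    (hS : ∀ i, (A i).IsSimple) (hniso : ∀ i j, i ≠ j → ¬ AbelianVariety.IsIsogenous (A i) (A j)) :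
    (∃ (N : ℕ) (π : Fin N → I) (m : ℕ) (c : complexBetti (⨁ fun j : Fin N => A (π j)).X (2 * m)),
        IsRationalClass c ∧
        IsOfHodgeType (⨁ fun j : Fin N => A (π j)).dim (⨁ fun j : Fin N => A (π j)).X (2 * m) m m c ∧
        c ∉ divisorClassesSpan (⨁ fun j : Fin N => A (π j)).X (⨁ fun j : Fin N => A (π j)).dim m) ↔
      ∃ i j, i ≠ j ∧
        ∃ F : IntermediateField ℚ (K i), finrank ℚ F = 2 ∧ IsTotallyComplex F ∧ Nonempty (F →+* K j) := by
  have hsep := CMAlgebra.isSeparatingFamily_of_isSimple_of_pairwise_not_isIsogenous hA hS hniso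
  have key := forall_prod_hodgeClassSpan_eq_iff_of_distinct_prime_dims hp hinj hA hS hniso
  have key' := CMAlgebra.isNondegenerateFamily_iff_forall_prod_hodgeClassSpan_eq hsep hA
  constructor
  · rintro ⟨N, π, m, c, hc, hpq, hnot⟩
    by_contra hno
    push Not at hno
    have hall : ∀ i j, i ≠ j →
        ¬ ∃ F : IntermediateField ℚ (K i), finrank ℚ F = 2 ∧ IsTotallyComplex F ∧ Nonempty (F →+* K j) :=
      fun i j hij => by
        rintro ⟨F, hF2, hFtc, hFn⟩
        exact (hno i j hij F hF2 hFtc).false hFn.some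
    exact ((key'.2 (key.2 hall)).not_exists_exceptional_prod hA π m) ⟨c, hc, hpq, hnot⟩
  · rintro ⟨i, j, hij, hF⟩
    refine CMAlgebra.exists_exceptional_prod_of_not_isNondegenerateFamily hsep (fun hnd => ?_) hA
    exact (key.1 (key'.1 hnd)) i j hij hF

end DistinctPrimes

end Summit.HodgeConjecture.CorCM

end
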